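import Mathlib
import HarnessLib
import Summits.KontsevichZagierPeriods.KontsevichZagierPeriods.Theses.FurushoPentagon
import Summits.KontsevichZagierPeriods.KontsevichZagierPeriods.Theorems.FurushoPentagonFurushoOverReduced
import Summits.KontsevichZagierPeriods.KontsevichZagierPeriods.Theorems.FurushoPentagonShuffleIsDissection
import Literature.NumberTheory.Transcendental.KZRulesAssociator
import Literature.NumberTheory.Transcendental.MZVShuffleRegularisationProofs

/-!
# Route FurushoPentagon — `DoubleShuffleOfPentagon`: the mechanism as one implication

Item stmt-KontsevichZagierPeriods-14669 (support): `PentagonInKZ → ReducedPeriodRing → DoubleShuffleInKZ`.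

Write `P := KZ.FormalRep ⧸ KZ.relations` (`KZ.FormalPeriodRing`) and `P_ℚ := ℚ ⊗ P`
(`KZ.FormalPeriodAlgebra`), `χ₀ : KZ.FormalRep → P_ℚ` the universal realisation of the rules, and
for a realisation `(R, χ, Z)` let
`Φ_{χ,Z} := Σ_W (−1)^{#X₁(W)} (Σ_v reg_ш(W)(v) · χ(Z(index of v))) · W ∈ R⟨⟨X₀, X₁⟩⟩` be the
`χ`-valued shuffle-regularised multiple zeta series of the route's items `PentagonInKZ` /
`DoubleShuffleInKZ`. The proof:

1. `ReducedPeriodRing` says `P` is reduced; `P_ℚ = ℚ ⊗_ℤ P` is the localisation of `P` at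
   `ℤ ∖ 0` (Mathlib `IsLocalization.tensorRight`), hence reduced
   (`isReduced_localizationPreserves`). (Torsion-freeness of `P`, the route's `IntegerDivision`,
   is not needed: localisation does not require injectivity of `P → P_ℚ`.)
2. `PentagonInKZ` at `(P_ℚ, χ₀)` is Drinfeld's pentagon for `Φ_{χ₀,Z}`.
3. For EVERY realisation, `Φ_{χ,Z}` is group-like (`isGroupLike_realisation`): on convergent words
   `v ↦ χ(Z(index of v))` is a shuffle character by the PROVED item `ShuffleIsDissection`
   (`shuffleIsDissection_proof`) pushed through `χ` (multiplicative, killing `KZ.relations`), and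
   IKZ's regularisation `reg_ш = MZV.shuffleReg` is a `ш`-homomorphism with values in `𝔥⁰`
   (`MZV.shuffleRegFS_shuffleSum`, `MZV.isConvergentWord_of_mem_support_shuffleReg`,
   [IharaKanekoZagier2006, §2 Prop. 1, §3, Cor. 5]); the sign `(−1)^{#X₁}` is multiplicative on
   shuffles.
4. The PROVED lever `FurushoOverReduced` (`furushoOverReduced_proof` = [Furusho2011, Thm 1.2] over
   reduced `ℚ`-algebras) at `R = P_ℚ` gives the generalised double shuffle relation for `Φ_{χ₀,Z}`.
5. Transport: `χ` kills `KZ.relations`, is multiplicative and non-degenerate, so it factors through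
   a ring homomorphism `f : P_ℚ → R` (`exists_realisation_lift`), `Φ_{χ,Z} = map f Φ_{χ₀,Z}`
   coefficientwise, and `GeneralisedDoubleShuffle.map` concludes.

References: H. Furusho, Ann. of Math. 174 (2011), Thm 1.2 [Furusho2011]; K. Ihara, M. Kaneko,
D. Zagier, Compos. Math. 142 (2006), §2–3 [IharaKanekoZagier2006]; G. Racinet, Publ. Math. IHÉS 95
(2002), Def. 3.1 [Racinet2002]; M. Kontsevich, D. Zagier, *Periods* (2001), §4.1
[KontsevichZagier2001].
-/

noncomputable section

open scoped BigOperators TensorProduct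
open Literature.NumberTheory.Transcendental
open Literature.NumberTheory.Transcendental.KZ
open Literature.NumberTheory.Transcendental.NCSeries
open Summit.KontsevichZagierPeriods.KontsevichZagierPeriods.Theses.FurushoPentagon
  (PentagonInKZ ReducedPeriodRing)

namespace Summit.KontsevichZagierPeriods.FurushoPentagon.DoubleShuffleOfPentagon

/-! ## 1. Word combinatorics -/

/-- Every interleaving of `u` and `v` is a permutation of `u ++ v`. [folklore] -/
theorem perm_append_of_mem_shuffleWord {α : Type*} :
    ∀ (u v : List α) {w : List α}, w ∈ MZV.shuffleWord u v → w.Perm (u ++ v)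
  | [], v, w, hw => by simp_all
  | a :: u, [], w, hw => by simp_all
  | a :: u, b :: v, w, hw => by
    simp only [MZV.shuffleWord_cons_cons, List.mem_append, List.mem_map] at hw
    rcases hw with ⟨w', hw', rfl⟩ | ⟨w', hw', rfl⟩
    · exact (perm_append_of_mem_shuffleWord u (b :: v) hw').cons a
    · exact ((perm_append_of_mem_shuffleWord (a :: u) v hw').cons b).trans List.perm_middle.symm

/-- Letter counts add under shuffling: `#_c(w) = #_c(u) + #_c(v)` for `w ∈ u ш v` (so the sign
`(−1)^{#X₁}` is multiplicative on shuffles). [folklore] -/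
theorem count_of_mem_shuffleWord {α : Type*} [DecidableEq α] {u v w : List α}
    (hw : w ∈ MZV.shuffleWord u v) (c : α) : w.count c = u.count c + v.count c := by
  rw [(perm_append_of_mem_shuffleWord u v hw).count_eq, List.count_append]

/-- A convergent word (empty, or `x … y`) is the binary word of its index. [folklore] -/
theorem binaryWord_ofBinaryWord_of_isConvergentWord {a : List Bool} (h : MZV.IsConvergentWord a) :
    MZV.binaryWord (MZV.ofBinaryWord a) = a := by
  rcases h with rfl | ⟨-, hl⟩
  · rfl
  · exact MZV.binaryWord_ofBinaryWord (by rintro rfl; simp at hl) hl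

/-- **Shuffles of convergent words are convergent**: an interleaving of two words of `𝔥⁰` begins
with the first letter of one of them (`x`) and ends with the last letter of one of them (`y`).
[cite: IharaKanekoZagier2006, §1 (𝔥⁰ is a subalgebra for ш)] -/
theorem isConvergentWord_of_mem_shuffleWord {a b w : List Bool} (ha : MZV.IsConvergentWord a)
    (hb : MZV.IsConvergentWord b) (hw : w ∈ MZV.shuffleWord a b) : MZV.IsConvergentWord w := by
  rcases ha with rfl | ⟨ha1, ha2⟩
  · rw [MZV.shuffleWord_nil_left, List.mem_singleton] at hw
    subst hw
    exact hb
  rcases hb with rfl | ⟨hb1, hb2⟩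
  · rw [MZV.shuffleWord_nil_right, List.mem_singleton] at hw
    subst hw
    exact Or.inr ⟨ha1, ha2⟩
  refine Or.inr ⟨?_, ?_⟩
  · rcases MZV.head?_of_mem_shuffleWord a b hw with h | h
    · rw [h, ha1]
    · rw [h, hb1]
  · rcases MZV.getLast?_of_mem_shuffleWord a b hw with h | h
    · rw [h, ha2]
    · rw [h, hb2]

/-! ## 2. Group-likeness of a shuffle-regularised character series -/

/-- **A shuffle character on `𝔥⁰` gives a group-like regularised series.** Let `zc : {words} → R`
(`R` a commutative `ℚ`-algebra) satisfy `zc(∅) = 1` and the shuffle relation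
`zc(a) zc(b) = Σ_{w ∈ a ш b} zc(w)` for CONVERGENT `a, b`. Then the series
`W ↦ (−1)^{#X₁(W)} Σ_v reg_ш(W)(v) zc(v)` is group-like: IKZ's `reg_ш = MZV.shuffleReg` is a
`ш`-homomorphism (`MZV.shuffleRegFS_shuffleSum`) with values in `𝔥⁰`
(`MZV.isConvergentWord_of_mem_support_shuffleReg`), so `W ↦ Σ_v reg_ш(W)(v) zc(v)` is a shuffle
character on ALL words, and `(−1)^{#X₁}` is multiplicative on shuffles. (Abstract form of the
group-likeness of `Φ_KZ`, [IharaKanekoZagier2006, Thm 1 in reg_ш form].)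
[cite: IharaKanekoZagier2006, §3 p. 314 and Thm 1] -/
theorem isGroupLike_of_shuffleCharacter {R : Type*} [CommRing R] [Algebra ℚ R] (zc : List Bool → R)
    (h1 : zc [] = 1)
    (h2 : ∀ a b : List Bool, MZV.IsConvergentWord a → MZV.IsConvergentWord b →
      zc a * zc b = ((MZV.shuffleWord a b).map zc).sum) :
    NCSeries.IsGroupLike (R := R) (fun W : List Bool =>
      (-1 : R) ^ (W.count true) * (MZV.shuffleReg W).sum (fun v a => a • zc v)) := by
  classical
  -- the `ℚ`-linear extension `L(Σ a_v v) = Σ a_v zc(v)` of `zc`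
  set L : (List Bool →₀ ℚ) →ₗ[ℚ] R := Finsupp.linearCombination ℚ zc with hL
  have hLapply : ∀ f : List Bool →₀ ℚ, L f = f.sum (fun v a => a • zc v) := fun f =>
    Finsupp.linearCombination_apply ℚ f
  -- `L(a ш b) = Σ_{w ∈ a ш b} zc(w)`
  have hC1 : ∀ a b : List Bool, L (MZV.shuffleSum a b) = ((MZV.shuffleWord a b).map zc).sum := by
    intro a b
    rw [MZV.shuffleSum, MZV.wordSum, map_list_sum, List.map_map]
    refine congrArg List.sum (List.map_congr_left fun w _ => ?_)
    simp [hL]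
  -- `L` is a character of `(𝔥⁰, ш)`
  have hC2 : ∀ f g : List Bool →₀ ℚ, (∀ w ∈ f.support, MZV.IsConvergentWord w) →
      (∀ w ∈ g.support, MZV.IsConvergentWord w) → L (MZV.shuffleFS f g) = L f * L g := by
    intro f g hf hg
    rw [MZV.shuffleFS, map_finsuppSum, hLapply f, hLapply g, Finsupp.sum_mul]
    simp only [Finsupp.mul_sum, map_finsuppSum, map_smul]
    simp only [Finsupp.sum]
    refine Finset.sum_congr rfl fun u hu => Finset.sum_congr rfl fun v hv => ?_
    rw [hC1, ← h2 u v (hf u hu) (hg v hv), smul_mul_smul_comm]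
  -- hence `W ↦ L(reg W)` is a character of `(𝔥, ш)`
  have hconv : ∀ u : List Bool, ∀ w ∈ (MZV.shuffleReg u).support, MZV.IsConvergentWord w :=
    fun u w hw => MZV.isConvergentWord_of_mem_support_shuffleReg hw
  have hC3 : ∀ u v : List Bool, L (MZV.shuffleReg u) * L (MZV.shuffleReg v) =
      ((MZV.shuffleWord u v).map fun w => L (MZV.shuffleReg w)).sum := by
    intro u v
    rw [← hC2 _ _ (hconv u) (hconv v), ← MZV.shuffleRegFS_shuffleSum, MZV.shuffleSum,
      MZV.shuffleRegFS_wordSum, map_list_sum, List.map_map]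
    rfl
  refine ⟨?_, fun u v => ?_⟩
  · show (-1 : R) ^ (([] : List Bool).count true) *
        (MZV.shuffleReg []).sum (fun v a => a • zc v) = 1
    rw [MZV.shuffleReg_of_isConvergentWord (Or.inl rfl)]
    simp [h1, Finsupp.sum_single_index]
  · show (-1 : R) ^ (u.count true) * (MZV.shuffleReg u).sum (fun v a => a • zc v) *
        ((-1 : R) ^ (v.count true) * (MZV.shuffleReg v).sum (fun v a => a • zc v)) =
      ((MZV.shuffleWord u v).map fun W =>
        (-1 : R) ^ (W.count true) * (MZV.shuffleReg W).sum (fun v a => a • zc v)).sum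
    simp only [← hLapply]
    rw [mul_mul_mul_comm, ← pow_add, hC3, ← List.sum_map_mul_left]
    refine congrArg List.sum (List.map_congr_left fun w hw => ?_)
    rw [count_of_mem_shuffleWord hw]

/-! ## 3. Realisations of the rules -/

/-- A realisation of the rules sends the unit representation `[pt, 1]` to `1`: from `χ u = 1` and
the unit law `[pt,1] · u − u ∈ KZ.relations` (`KZ.of_unit_mul_sub_mem_relations`),
`χ[pt,1] = χ[pt,1] χ(u) = χ([pt,1] · u) = χ(u) = 1`. [cite: KontsevichZagier2001, §4.1] -/
theorem realisation_of_unit {R : Type*} [CommRing R] (χ : FormalRep →+ R)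
    (hrel : ∀ c ∈ relations, χ c = 0) (hmul : ∀ a b : FormalRep, χ (a * b) = χ a * χ b)
    (hunit : ∃ u : FormalRep, χ u = 1) : χ (of IntegralRep.unit) = 1 := by
  obtain ⟨u, hu⟩ := hunit
  have h := hrel _ (of_unit_mul_sub_mem_relations u)
  rw [map_sub, sub_eq_zero, hmul, hu, mul_one] at h
  exact h

/-- **The regularised series of a realisation is group-like.** For every commutative `ℚ`-algebra
`R`, every realisation `χ` of the Kontsevich–Zagier rules (additive, killing `KZ.relations`,
multiplicative, non-degenerate) and every `Z` pinned to the simplex classes on admissible indices,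
the `χ`-valued shuffle-regularised multiple zeta series `Φ_{χ,Z}` is group-like: on convergent
words `v ↦ χ(Z(index of v))` is a shuffle character by `ShuffleIsDissection`
(`shuffleIsDissection_proof`: products of simplices dissect into shuffled simplices) pushed through
`χ`, with `χ(Z ∅) = χ[pt,1] = 1`; then `isGroupLike_of_shuffleCharacter`.
[cite: IharaKanekoZagier2006, Thm 1] -/
theorem isGroupLike_realisation (R : Type) [CommRing R] [Algebra ℚ R] (χ : FormalRep →+ R)
    (hrel : ∀ c ∈ relations, χ c = 0) (hmul : ∀ a b : FormalRep, χ (a * b) = χ a * χ b)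
    (hunit : ∃ u : FormalRep, χ u = 1) (Z : List ℕ → FormalRep)
    (hZ : ∀ (u : List ℕ) (hu : MZV.IsAdmissible u), Z u = of (mzvRep u hu
      (mzvIntegrand_isSemialgebraicFunOn_holds u) (mzvIntegrand_integrableOn_holds u hu))) :
    NCSeries.IsGroupLike (R := R) (fun W : List Bool => (-1 : R) ^ (W.count true) *
      (MZV.shuffleReg W).sum (fun v a => a •
        (if MZV.IsConvergentWord v then χ (Z (MZV.ofBinaryWord v)) else (0 : R)))) := by
  refine isGroupLike_of_shuffleCharacter
    (fun v => if MZV.IsConvergentWord v then χ (Z (MZV.ofBinaryWord v)) else 0) ?_ ?_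
  · show (if MZV.IsConvergentWord [] then χ (Z (MZV.ofBinaryWord [])) else 0) = 1
    rw [if_pos (show MZV.IsConvergentWord [] from Or.inl rfl), MZV.ofBinaryWord_nil,
      hZ [] MZV.isAdmissible_nil, mzvRep_nil]
    exact realisation_of_unit χ hrel hmul hunit
  · intro a b ha hb
    have hsa : MZV.IsAdmissible (MZV.ofBinaryWord a) := MZV.isAdmissible_ofBinaryWord ha.head?_ne
    have hsb : MZV.IsAdmissible (MZV.ofBinaryWord b) := MZV.isAdmissible_ofBinaryWord hb.head?_ne
    have h := hrel _ (ShuffleIsDissection.shuffleIsDissection_proof Z hZ _ _ hsa hsb)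
    rw [binaryWord_ofBinaryWord_of_isConvergentWord ha,
      binaryWord_ofBinaryWord_of_isConvergentWord hb, map_sub, sub_eq_zero, hmul, map_list_sum,
      List.map_map] at h
    show (if MZV.IsConvergentWord a then χ (Z (MZV.ofBinaryWord a)) else 0) *
        (if MZV.IsConvergentWord b then χ (Z (MZV.ofBinaryWord b)) else 0) =
      ((MZV.shuffleWord a b).map fun v =>
        if MZV.IsConvergentWord v then χ (Z (MZV.ofBinaryWord v)) else 0).sum
    rw [if_pos ha, if_pos hb, h]
    refine congrArg List.sum (List.map_congr_left fun w hw => ?_)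
    rw [Function.comp_apply, if_pos (isConvergentWord_of_mem_shuffleWord ha hb hw)]

/-- **Realisations factor through `P_ℚ`.** A realisation `χ : KZ.FormalRep → R` of the rules into a
commutative `ℚ`-algebra (additive, killing `KZ.relations`, multiplicative, non-degenerate) induces
a ring homomorphism `χ̄ : P = FormalRep ⧸ relations → R` (unital by `realisation_of_unit`) and then
`f = ℚ ⊗ χ̄ : P_ℚ → R` with `f(1 ⊗ ⟦c⟧) = χ(c)`. [cite: KontsevichZagier2001, §4.1] -/
theorem exists_realisation_lift (R : Type) [CommRing R] [Algebra ℚ R] (χ : FormalRep →+ R)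
    (hrel : ∀ c ∈ relations, χ c = 0) (hmul : ∀ a b : FormalRep, χ (a * b) = χ a * χ b)
    (hunit : ∃ u : FormalRep, χ u = 1) :
    ∃ f : FormalPeriodAlgebra →ₐ[ℚ] R,
      ∀ c : FormalRep, f (toPeriodAlgebra (toFormalPeriod c)) = χ c := by
  have h1 : χ (of IntegralRep.unit) = 1 := realisation_of_unit χ hrel hmul hunit
  let χbar : FormalPeriodRing →+* R :=
    { toFun := Quotient.lift (χ : FormalRep → R) fun a b (h : ringCon a b) => by
        rw [ringCon_apply] at h
        have h0 : χ (a - b) = 0 := hrel _ h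
        rwa [map_sub, sub_eq_zero] at h0
      map_one' := by
        change χ (of IntegralRep.unit) = 1
        exact h1
      map_mul' := fun x y => by
        induction x using Quotient.inductionOn' with | h c => ?_
        induction y using Quotient.inductionOn' with | h d => ?_
        exact hmul c d
      map_zero' := by
        change χ (0 : FormalRep) = 0
        exact map_zero χ
      map_add' := fun x y => by
        induction x using Quotient.inductionOn' with | h c => ?_
        induction y using Quotient.inductionOn' with | h d => ?_
        exact map_add χ c d }
  have hbar : ∀ c : FormalRep, χbar (toFormalPeriod c) = χ c := fun c => rfl
  refine ⟨Algebra.TensorProduct.lift (Algebra.ofId ℚ R) χbar.toIntAlgHom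
    (fun _ _ => Commute.all _ _), fun c => ?_⟩
  rw [toPeriodAlgebra_apply, Algebra.TensorProduct.lift_tmul, map_one, one_mul]
  exact hbar c

/-! ## 4. `P_ℚ` is reduced when `P` is -/

/-- `ReducedPeriodRing` (no `c ∉ relations` with `c · c ∈ relations`) says exactly that the formal
period ring `P = KZ.FormalRep ⧸ KZ.relations` is reduced. [folklore] -/
theorem isReduced_formalPeriodRing (hR : ReducedPeriodRing) : IsReduced FormalPeriodRing := by
  rw [isReduced_iff_pow_one_lt 2 one_lt_two]
  intro x hx
  obtain ⟨c, rfl⟩ := toFormalPeriod_surjective x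
  rw [pow_two, ← map_mul, toFormalPeriod_eq_zero_iff] at hx
  exact toFormalPeriod_eq_zero_iff.mpr (hR c hx)

/-- **`P_ℚ = ℚ ⊗_ℤ P` is reduced when `P` is**: it is the localisation of `P` at the image of
`ℤ ∖ 0` (Mathlib `IsLocalization.tensorRight`, `ℚ = Frac ℤ`), and localisations of reduced rings
are reduced (`isReduced_localizationPreserves`). [folklore] -/
theorem isReduced_formalPeriodAlgebra (hR : ReducedPeriodRing) : IsReduced FormalPeriodAlgebra := by
  haveI : IsReduced FormalPeriodRing := isReduced_formalPeriodRing hR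
  letI : Algebra FormalPeriodRing FormalPeriodAlgebra := Algebra.TensorProduct.rightAlgebra
  haveI : IsLocalization (Algebra.algebraMapSubmonoid FormalPeriodRing (nonZeroDivisors ℤ))
      FormalPeriodAlgebra :=
    IsLocalization.tensorRight ℚ (nonZeroDivisors ℤ)
  exact isReduced_localizationPreserves
    (Algebra.algebraMapSubmonoid FormalPeriodRing (nonZeroDivisors ℤ)) FormalPeriodAlgebra
    inferInstance

/-! ## 5. The mechanism -/

/-- **`DoubleShuffleOfPentagon` (stmt-KontsevichZagierPeriods-14669) holds**:
`PentagonInKZ → ReducedPeriodRing → DoubleShuffleInKZ`. Given a realisation `(R, χ, Z)`: the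
universal realisation `χ₀ : FormalRep → P_ℚ = ℚ ⊗ (FormalRep ⧸ relations)` kills the relations, is
multiplicative and has `χ₀[pt,1] = 1`; `PentagonInKZ` at `(P_ℚ, χ₀, Z)` is Drinfeld's pentagon for
`Φ_{χ₀,Z}`, which is group-like (`isGroupLike_realisation`); `P_ℚ` is reduced
(`isReduced_formalPeriodAlgebra`), so Furusho's theorem over reduced `ℚ`-algebras
(`furushoOverReduced_proof`, [Furusho2011, Thm 1.2]) gives `Δ_*(Φ_*) = Φ_* ⊗̂ Φ_*` for `Φ_{χ₀,Z}`;
finally `χ` factors through a ring map `f : P_ℚ → R` (`exists_realisation_lift`),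
`Φ_{χ,Z} = map f Φ_{χ₀,Z}` coefficientwise, and the relation is preserved by change of
coefficients (`GeneralisedDoubleShuffle.map`). [cite: Furusho2011, Thm 1.2] -/
theorem doubleShuffleOfPentagon_proof :
    Summit.KontsevichZagierPeriods.KontsevichZagierPeriods.Theses.FurushoPentagon.DoubleShuffleOfPentagon := by
  unfold Summit.KontsevichZagierPeriods.KontsevichZagierPeriods.Theses.FurushoPentagon.DoubleShuffleOfPentagon
    Summit.KontsevichZagierPeriods.KontsevichZagierPeriods.Theses.FurushoPentagon.DoubleShuffleInKZ
  intro hP hR R _ _ χ hrel hmul hunit Z hZ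
  -- the universal realisation `χ₀ : FormalRep → P_ℚ`
  obtain ⟨χ₀, hχ₀⟩ : ∃ χ₀ : FormalRep →+ FormalPeriodAlgebra,
      ∀ c : FormalRep, χ₀ c = toPeriodAlgebra (toFormalPeriod c) :=
    ⟨(toPeriodAlgebra : FormalPeriodRing →ₐ[ℤ] FormalPeriodAlgebra).toRingHom.toAddMonoidHom.comp
        (toFormalPeriod : FormalRep →ₙ+* FormalPeriodRing).toAddMonoidHom, fun _ => rfl⟩
  have h0rel : ∀ c ∈ relations, χ₀ c = 0 := fun c hc => by
    rw [hχ₀, toFormalPeriod_eq_zero_of_mem hc, map_zero]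
  have h0mul : ∀ a b : FormalRep, χ₀ (a * b) = χ₀ a * χ₀ b := fun a b => by
    rw [hχ₀, hχ₀, hχ₀, map_mul, map_mul]
  have h0unit : ∃ u : FormalRep, χ₀ u = 1 :=
    ⟨of IntegralRep.unit, by rw [hχ₀, toFormalPeriod_of_unit, map_one]⟩
  -- pentagon, group-likeness, reducedness at the universal realisation; Furusho's theorem
  have hP0 := hP FormalPeriodAlgebra χ₀ h0rel h0mul h0unit Z hZ
  have hG0 := isGroupLike_realisation FormalPeriodAlgebra χ₀ h0rel h0mul h0unit Z hZ
  haveI : IsReduced FormalPeriodAlgebra := isReduced_formalPeriodAlgebra hR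
  have hD0 := FurushoOverReduced.furushoOverReduced_proof FormalPeriodAlgebra _ hG0 hP0
  -- transport along `f : P_ℚ → R`
  obtain ⟨f, hf⟩ := exists_realisation_lift R χ hrel hmul hunit
  convert hD0.map (f : FormalPeriodAlgebra →+* R) using 1
  funext W
  rw [NCSeries.map_apply, AlgHom.coe_toRingHom, map_mul, map_pow, map_neg, map_one,
    map_finsuppSum]
  congr 1
  refine Finsupp.sum_congr fun v _ => ?_
  rw [map_smul]
  congr 1
  split_ifs
  · rw [hχ₀, hf]
  · rw [map_zero]

end Summit.KontsevichZagierPeriods.FurushoPentagon.DoubleShuffleOfPentagon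

end
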